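import Summits.AnomalousDissipation.AnomalousDissipation.Theorems.SolenoidalFractalHomogenisationLagrangianStepW7ThreeModeFibre
import Mathlib.Algebra.Polynomial.Derivative
import Mathlib.Algebra.Polynomial.Degree.Support
import Mathlib.Algebra.Polynomial.BigOperators
import HarnessLib

/-!
# K1L_D `LagrangianRenormalisationStepDesign` (stmt-AnomalousDissipation-27980), `stub_D1_V0` (V0 = clause (ii) of
# `WCrossing.D1ExactFamily`): the LERAY-PROJECTED SYMBOL ALONG A LINE OF WAVE VECTORS IS A DEGREE-6 POLYNOMIAL WHOSE VALUES ARE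
# TRANSVERSE DATA — generic form, degree bound, exact seven-point stencil, node bounds, Bernstein–Markov bound of the derivative
# (helper; `--kind proof --supports stmt-AnomalousDissipation-27980 --as helper`)

Summits-side helper file of route `SolenoidalFractalHomogenisation` (prover seat `ad-k1l-cellLawV-w1` g6; FINDING F-w1g6-1 on the
cell STATUS board 2026-08-29T01:48Z), part 1 of 2 (part 2: `…TransverseSymbolLipschitz`).  Everything proved; no named facts, no sorry.

THE POINT.  The (V) clause `SlowVectorClauseNoExF` quantifies over ALL viscosity tensors `𝔸 : Visc4 (Fin 3)` subject only to
TRANSVERSE control (`NearIso 𝔸 lo hi`, `OddSmall 𝔸 β`), and its constant is chosen before `𝔸`.  The true fast block of the cell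
chain damps the class mode `z` through the Leray-projected symbol `F(k) = P_k T_𝔸(k) P_k` at `k = ℓ + n·z`, the reference generator
(`Sideband.gen`, hence `psiStar`) through `F(n·z)`; every proof of (V) therefore needs a DIRECTION-LIPSCHITZ bound of `F` with an
ABSOLUTE constant times the transverse bound `K₀` (`K₀ = hi + β/2`, `…ThreeMode.abs_bsymb_le`), although the 81 entries of `𝔸` are not
bounded by transverse data (the naive `‖T_𝔸(k) − T_𝔸(k')‖ ≤ ‖𝔸‖|k||k − k'|` is unavailable).  THIS FILE: along `k_s = k + s·δ` the
numerator `N(s) = β_𝔸(k_s; |k_s|²π_{k_s} p, |k_s|²π_{k_s} q)` is a POLYNOMIAL of degree `≤ 6` (§1 generic form over a commutative ring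
+ functoriality under ring maps, §2 degree count) all of whose values are transverse data, `|N(s)| ≤ K₀|k_s|⁶|p||q|` (§3); the EXACT
seven-point stencil `60h·P'(0) = −P(−3h)+9P(−2h)−45P(−h)+45P(h)−9P(2h)+P(3h)` for `deg P ≤ 6` (§2) with `h = |k|/(3|δ|)` gives the
Bernstein–Markov bound `|N'(0)|·|k| ≤ 352·K₀·|k|⁶·|δ|·|p||q|` (§4).  Part 2 turns this into
`|⟨π p, T(k+δ) π q⟩ − ⟨π p, T(k) π q⟩| ≤ 534·K₀·|k||δ||p||q|` and its `ℂ³`/`transversalProj` packaging for the T4 residual estimate of the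
V0 architecture (`Cruxes/LagrangianRenormalisationStep/Lines/onelevel-V0-exact-family.md` §4).
NOT a proof of any registered stub, of K1L_D, or of anomalous dissipation; rung F-D1.A0 infrastructure.
-/

set_option linter.dupNamespace false

noncomputable section

namespace Summit.AnomalousDissipation.AnomalousDissipation.Theorems.SolenoidalFractalHomogenisation.LagrangianStep.SymbolLipschitz

open Finset Polynomial
open Literature.Analysis Literature.Analysis.FluidPDE Literature.Analysis.FluidPDE.Torus

/-! ## §1 The projected bilinear symbol as a polynomial expression over a commutative ring -/

section Generic

variable {R : Type*} [CommRing R]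

/-- `p·k` (the pairing whose vanishing is transversality, in the argument order of `NearIso`/`OddSmall`). [folklore] -/
def dotR (k p : Fin 3 → R) : R := ∑ i, p i * k i

/-- `|k|²`. [folklore] -/
def nsqR (k : Fin 3 → R) : R := ∑ a, k a ^ 2

/-- The un-normalised Leray projection `|k|²·π_k p = |k|²p − (p·k)k` (polynomial in `k`). [cite: Temam1984, Ch. III §1.1] -/
def projR (k p : Fin 3 → R) : Fin 3 → R := fun i => nsqR k * p i - dotR k p * k i

/-- The bilinear symbol `β_𝔸(k; p, q) = Σ 𝔸 i a j b pᵢ kₐ qⱼ k_b` over a commutative ring (over `ℝ` this is `Torus.bsymb`).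
[cite: Frisch1995Turbulence, §9.6.3 eq. (9.57) p. 233] -/
def bsymbR (𝔸 : Fin 3 → Fin 3 → Fin 3 → Fin 3 → R) (k p q : Fin 3 → R) : R :=
  ∑ i, ∑ a, ∑ j, ∑ b, 𝔸 i a j b * p i * k a * q j * k b

/-- The projected symbol numerator `G(k; p, q) = β_𝔸(k; |k|²π_k p, |k|²π_k q) = |k|⁴·⟨π_k p, T_𝔸(k) π_k q⟩` (degree `6` in `k`).
[cite: Frisch1995Turbulence, §9.6.3 eq. (9.57) p. 233] -/
def GR (𝔸 : Fin 3 → Fin 3 → Fin 3 → Fin 3 → R) (k p q : Fin 3 → R) : R := bsymbR 𝔸 k (projR k p) (projR k q)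

/-- Over `ℝ`, `bsymbR` is the tree's `Torus.bsymb` (definitional). [cite: Frisch1995Turbulence, §9.6.3 eq. (9.57) p. 233] -/
theorem bsymbR_eq_bsymb (𝔸 : Visc4 (Fin 3)) (k p q : Fin 3 → ℝ) : bsymbR 𝔸 k p q = bsymb 𝔸 k p q := rfl

/-- `|k|²π_k p` is transversal: `(|k|²π_k p)·k = 0`. [cite: Temam1984, Ch. III §1.1] -/
theorem dotR_projR (k p : Fin 3 → R) : dotR k (projR k p) = 0 := by
  have h1 : ∀ i, projR k p i * k i = nsqR k * (p i * k i) - dotR k p * k i ^ 2 := fun i => by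
    simp only [projR]; ring
  calc dotR k (projR k p) = ∑ i, projR k p i * k i := rfl
    _ = nsqR k * ∑ i, p i * k i - dotR k p * ∑ i, k i ^ 2 := by
        simp_rw [h1]; rw [Finset.sum_sub_distrib, Finset.mul_sum, Finset.mul_sum]
    _ = 0 := by rw [show ∑ i, p i * k i = dotR k p from rfl, show ∑ i, k i ^ 2 = nsqR k from rfl]; ring

/-- Functoriality: a ring homomorphism passes through `G`. [folklore] -/
theorem map_GR {S : Type*} [CommRing S] (f : R →+* S) (𝔸 : Fin 3 → Fin 3 → Fin 3 → Fin 3 → R) (k p q : Fin 3 → R) :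
    f (GR 𝔸 k p q) = GR (fun i a j b => f (𝔸 i a j b)) (fun a => f (k a)) (fun i => f (p i)) (fun i => f (q i)) := by
  simp [GR, bsymbR, projR, nsqR, dotR, map_sum, map_mul, map_sub, map_pow]

/-- Functoriality of `|k|²`. [folklore] -/
theorem map_nsqR {S : Type*} [CommRing S] (f : R →+* S) (k : Fin 3 → R) : f (nsqR k) = nsqR (fun a => f (k a)) := by
  simp [nsqR, map_sum, map_pow]

end Generic

/-! ## §2 The degree bound along a line and the exact seven-point stencil -/

/-- The line `s ↦ k + s·δ` as a vector of polynomials. [folklore] -/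
def lineX (k δ : Fin 3 → ℝ) : Fin 3 → ℝ[X] := fun a => C (k a) + C (δ a) * X

/-- The numerator `N(s) = G(k + sδ; p, q)` as a polynomial in `s`. [folklore] -/
def GX (𝔸 : Visc4 (Fin 3)) (k δ p q : Fin 3 → ℝ) : ℝ[X] :=
  GR (fun i a j b => C (𝔸 i a j b)) (lineX k δ) (fun i => C (p i)) (fun i => C (q i))

/-- The denominator's square root `|k + sδ|²` as a polynomial in `s`. [folklore] -/
def nsqX (k δ : Fin 3 → ℝ) : ℝ[X] := nsqR (lineX k δ)

/-- Evaluation of the line. [folklore] -/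
theorem eval_lineX (k δ : Fin 3 → ℝ) (s : ℝ) (a : Fin 3) : (lineX k δ a).eval s = (k + s • δ) a := by
  simp only [lineX, eval_add, eval_C, eval_mul, eval_X, Pi.add_apply, Pi.smul_apply, smul_eq_mul]
  ring

/-- `N(s)` is the evaluation of the polynomial `GX`. [folklore] -/
theorem eval_GX (𝔸 : Visc4 (Fin 3)) (k δ p q : Fin 3 → ℝ) (s : ℝ) : (GX 𝔸 k δ p q).eval s = GR 𝔸 (k + s • δ) p q := by
  have h := map_GR (Polynomial.evalRingHom s) (fun i a j b => C (𝔸 i a j b)) (lineX k δ) (fun i => C (p i)) (fun i => C (q i))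
  simp only [Polynomial.coe_evalRingHom, eval_C] at h
  rw [GX, h]
  congr 1
  funext a
  exact eval_lineX k δ s a

/-- `|k + sδ|²` is the evaluation of the polynomial `nsqX`. [folklore] -/
theorem eval_nsqX (k δ : Fin 3 → ℝ) (s : ℝ) : (nsqX k δ).eval s = nsqR (k + s • δ) := by
  have h := map_nsqR (Polynomial.evalRingHom s) (lineX k δ)
  simp only [Polynomial.coe_evalRingHom] at h
  rw [nsqX, h]
  congr 1
  funext a
  exact eval_lineX k δ s a

/-- Each coordinate of the line has degree `≤ 1`. [folklore] -/
theorem natDegree_lineX_le (k δ : Fin 3 → ℝ) (a : Fin 3) : (lineX k δ a).natDegree ≤ 1 := by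
  unfold lineX
  refine natDegree_add_le_of_degree_le (le_trans (natDegree_C _).le (Nat.zero_le _)) ?_
  exact le_trans natDegree_mul_le (by simp)

/-- `|k + sδ|²` has degree `≤ 2`. [folklore] -/
theorem natDegree_nsqX_le (k δ : Fin 3 → ℝ) : (nsqX k δ).natDegree ≤ 2 := by
  unfold nsqX nsqR
  refine natDegree_sum_le_of_forall_le _ _ fun a _ => ?_
  simpa using natDegree_pow_le_of_le 2 (natDegree_lineX_le k δ a)

/-- The pairing `p·(k + sδ)` has degree `≤ 1` for constant `p`. [folklore] -/
theorem natDegree_dotR_lineX_le (k δ p : Fin 3 → ℝ) : (dotR (lineX k δ) (fun i => C (p i))).natDegree ≤ 1 := by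
  unfold dotR
  refine natDegree_sum_le_of_forall_le _ _ fun i _ => ?_
  simpa using natDegree_mul_le_of_le (natDegree_C (p i)).le (natDegree_lineX_le k δ i)

/-- Each coordinate of `|k_s|²π_{k_s} p` has degree `≤ 2`. [folklore] -/
theorem natDegree_projR_lineX_le (k δ p : Fin 3 → ℝ) (i : Fin 3) :
    (projR (lineX k δ) (fun i => C (p i)) i).natDegree ≤ 2 := by
  unfold projR
  have h0 : (nsqR (lineX k δ)).natDegree ≤ 2 := natDegree_nsqX_le k δ
  have h1 : (nsqR (lineX k δ) * C (p i)).natDegree ≤ 2 := by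
    simpa using natDegree_mul_le_of_le h0 (natDegree_C (p i)).le
  have h2 : (dotR (lineX k δ) (fun i => C (p i)) * lineX k δ i).natDegree ≤ 2 := by
    simpa using natDegree_mul_le_of_le (natDegree_dotR_lineX_le k δ p) (natDegree_lineX_le k δ i)
  simpa using natDegree_sub_le_of_le h1 h2

/-- **The numerator along a line is a polynomial of degree `≤ 6`.** [folklore] -/
theorem natDegree_GX_le (𝔸 : Visc4 (Fin 3)) (k δ p q : Fin 3 → ℝ) : (GX 𝔸 k δ p q).natDegree ≤ 6 := by
  unfold GX GR bsymbR
  refine natDegree_sum_le_of_forall_le _ _ fun i _ => natDegree_sum_le_of_forall_le _ _ fun a _ =>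
    natDegree_sum_le_of_forall_le _ _ fun j _ => natDegree_sum_le_of_forall_le _ _ fun b _ => ?_
  have h1 := natDegree_mul_le_of_le (natDegree_C (𝔸 i a j b)).le (natDegree_projR_lineX_le k δ p i)
  have h2 := natDegree_mul_le_of_le h1 (natDegree_lineX_le k δ a)
  have h3 := natDegree_mul_le_of_le h2 (natDegree_projR_lineX_le k δ q j)
  have h4 := natDegree_mul_le_of_le h3 (natDegree_lineX_le k δ b)
  simpa using h4

/-- **The exact seven-point stencil** for polynomials of degree `≤ 6`:
`60h·P'(0) = −P(−3h) + 9P(−2h) − 45P(−h) + 45P(h) − 9P(2h) + P(3h)`. [folklore] -/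
theorem stencil7 (P : ℝ[X]) (hP : P.natDegree ≤ 6) (h : ℝ) :
    60 * h * P.derivative.eval 0 =
      -P.eval (-(3 * h)) + 9 * P.eval (-(2 * h)) - 45 * P.eval (-h) + 45 * P.eval h - 9 * P.eval (2 * h) + P.eval (3 * h) := by
  have hP7 : P.natDegree < 7 := by omega
  rw [P.as_sum_range' 7 hP7]
  simp only [Finset.sum_range_succ, Finset.sum_range_zero]
  norm_num
  ring


/-! ## §3 Node bounds: transverse data along the line -/

/-- `|k|² ≥ 0`. [folklore] -/
theorem nsqR_nonneg (k : Fin 3 → ℝ) : 0 ≤ nsqR k := Finset.sum_nonneg fun a _ => sq_nonneg (k a)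

/-- `Σ (|k|²π_k p)ᵢ² = |k|⁴|p|² − |k|²(p·k)²`. [cite: Temam1984, Ch. III §1.1] -/
theorem sum_sq_projR_eq (k p : Fin 3 → ℝ) :
    ∑ i, projR k p i ^ 2 = nsqR k ^ 2 * (∑ i, p i ^ 2) - nsqR k * dotR k p ^ 2 := by
  have h1 : ∀ i, projR k p i ^ 2
      = nsqR k ^ 2 * p i ^ 2 - 2 * (nsqR k * dotR k p) * (p i * k i) + dotR k p ^ 2 * k i ^ 2 := fun i => by
    simp only [projR]; ring
  simp_rw [h1]
  rw [Finset.sum_add_distrib, Finset.sum_sub_distrib, ← Finset.mul_sum, ← Finset.mul_sum, ← Finset.mul_sum,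
    show ∑ i, p i * k i = dotR k p from rfl, show ∑ i, k i ^ 2 = nsqR k from rfl]
  ring

/-- `|(|k|²π_k p)| ≤ |k|²|p|` (squared). [cite: Temam1984, Ch. III §1.1] -/
theorem sum_sq_projR_le (k p : Fin 3 → ℝ) : ∑ i, projR k p i ^ 2 ≤ nsqR k ^ 2 * ∑ i, p i ^ 2 := by
  rw [sum_sq_projR_eq]
  nlinarith [nsqR_nonneg k, sq_nonneg (dotR k p)]

/-- `|(|k|²π_k p)| ≤ |k|²|p|` (with square roots). [cite: Temam1984, Ch. III §1.1] -/
theorem sqrt_sum_sq_projR_le (k p : Fin 3 → ℝ) :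
    Real.sqrt (∑ i, projR k p i ^ 2) ≤ nsqR k * Real.sqrt (∑ i, p i ^ 2) := by
  calc Real.sqrt (∑ i, projR k p i ^ 2) ≤ Real.sqrt (nsqR k ^ 2 * ∑ i, p i ^ 2) := Real.sqrt_le_sqrt (sum_sq_projR_le k p)
    _ = nsqR k * Real.sqrt (∑ i, p i ^ 2) := by
        rw [Real.sqrt_mul (sq_nonneg _), Real.sqrt_sq (nsqR_nonneg k)]

/-- Cauchy–Schwarz: `|p·k| ≤ |k||p|`. [folklore] -/
theorem abs_dotR_le (k p : Fin 3 → ℝ) : |dotR k p| ≤ Real.sqrt (nsqR k) * Real.sqrt (nsqR p) := by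
  have h : dotR k p ^ 2 ≤ (Real.sqrt (nsqR k) * Real.sqrt (nsqR p)) ^ 2 := by
    rw [mul_pow, Real.sq_sqrt (nsqR_nonneg k), Real.sq_sqrt (nsqR_nonneg p), dotR, nsqR, nsqR, mul_comm]
    exact Finset.sum_mul_sq_le_sq_mul_sq _ _ _
  exact ThreeMode.abs_le_of_sq_le_sq'' h (by positivity)

/-- `|k + sδ|² = |k|² + 2s(δ·k) + s²|δ|²`. [folklore] -/
theorem nsqR_add_smul (k δ : Fin 3 → ℝ) (s : ℝ) : nsqR (k + s • δ) = nsqR k + 2 * s * dotR k δ + s ^ 2 * nsqR δ := by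
  simp only [nsqR, dotR, Pi.add_apply, Pi.smul_apply, smul_eq_mul, Finset.mul_sum, ← Finset.sum_add_distrib]
  exact Finset.sum_congr rfl fun a _ => by ring

/-- `|k + sδ| ≤ |k| + |s||δ|` (squared). [folklore] -/
theorem nsqR_add_smul_le (k δ : Fin 3 → ℝ) (s : ℝ) :
    nsqR (k + s • δ) ≤ (Real.sqrt (nsqR k) + |s| * Real.sqrt (nsqR δ)) ^ 2 := by
  rw [nsqR_add_smul, add_sq, mul_pow, sq_abs, Real.sq_sqrt (nsqR_nonneg k), Real.sq_sqrt (nsqR_nonneg δ)]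
  have h1 := abs_dotR_le k δ
  have h2 : 2 * s * dotR k δ ≤ 2 * |s| * (Real.sqrt (nsqR k) * Real.sqrt (nsqR δ)) := by
    calc 2 * s * dotR k δ ≤ |2 * s * dotR k δ| := le_abs_self _
      _ = 2 * |s| * |dotR k δ| := by rw [abs_mul, abs_mul, abs_two]
      _ ≤ 2 * |s| * (Real.sqrt (nsqR k) * Real.sqrt (nsqR δ)) := by gcongr
  nlinarith [h2]

/-- `|k + sδ| ≥ |k| − |s||δ|` (squared). [folklore] -/
theorem sq_sub_le_nsqR_add_smul (k δ : Fin 3 → ℝ) (s : ℝ) :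
    (Real.sqrt (nsqR k) - |s| * Real.sqrt (nsqR δ)) ^ 2 ≤ nsqR (k + s • δ) := by
  rw [nsqR_add_smul, sub_sq, mul_pow, sq_abs, Real.sq_sqrt (nsqR_nonneg k), Real.sq_sqrt (nsqR_nonneg δ)]
  have h1 := abs_dotR_le k δ
  have h2 : -(2 * |s| * (Real.sqrt (nsqR k) * Real.sqrt (nsqR δ))) ≤ 2 * s * dotR k δ := by
    calc -(2 * |s| * (Real.sqrt (nsqR k) * Real.sqrt (nsqR δ))) ≤ -(2 * |s| * |dotR k δ|) := by gcongr
      _ = -|2 * s * dotR k δ| := by rw [abs_mul, abs_mul, abs_two]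
      _ ≤ 2 * s * dotR k δ := neg_abs_le _
  nlinarith [h2]

/-- **Node bound**: every value of the numerator is transverse data, `|G(k; p, q)| ≤ K₀·|k|⁶·|p|·|q|`. [folklore] -/
theorem abs_GR_le {𝔸 : Visc4 (Fin 3)} {K₀ : ℝ} (hK₀ : 0 ≤ K₀)
    (hK : ∀ k p q : Fin 3 → ℝ, ∑ i, p i * k i = 0 → ∑ i, q i * k i = 0 →
      |bsymb 𝔸 k p q| ≤ K₀ * (∑ a, k a ^ 2) * (Real.sqrt (∑ i, p i ^ 2) * Real.sqrt (∑ i, q i ^ 2)))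
    (k p q : Fin 3 → ℝ) :
    |GR 𝔸 k p q| ≤ K₀ * nsqR k ^ 3 * (Real.sqrt (∑ i, p i ^ 2) * Real.sqrt (∑ i, q i ^ 2)) := by
  have hp : ∑ i, projR k p i * k i = 0 := dotR_projR k p
  have hq : ∑ i, projR k q i * k i = 0 := dotR_projR k q
  have h := hK k (projR k p) (projR k q) hp hq
  rw [GR, bsymbR_eq_bsymb]
  refine le_trans h ?_
  have hn := nsqR_nonneg k
  have h1 := sqrt_sum_sq_projR_le k p
  have h2 := sqrt_sum_sq_projR_le k q
  have hP := Real.sqrt_nonneg (∑ i, projR k p i ^ 2)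
  have hQ := Real.sqrt_nonneg (∑ i, projR k q i ^ 2)
  calc K₀ * (∑ a, k a ^ 2) * (Real.sqrt (∑ i, projR k p i ^ 2) * Real.sqrt (∑ i, projR k q i ^ 2))
      ≤ K₀ * nsqR k * ((nsqR k * Real.sqrt (∑ i, p i ^ 2)) * (nsqR k * Real.sqrt (∑ i, q i ^ 2))) := by
        rw [show (∑ a, k a ^ 2) = nsqR k from rfl]
        exact mul_le_mul_of_nonneg_left (mul_le_mul h1 h2 hQ (by positivity)) (by positivity)
    _ = K₀ * nsqR k ^ 3 * (Real.sqrt (∑ i, p i ^ 2) * Real.sqrt (∑ i, q i ^ 2)) := by ring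

/-- Node bound along the line: if `|σ|·|δ| ≤ |k|` then `|N(σ)| ≤ 64·K₀·|k|⁶·|p||q|`. [folklore] -/
theorem abs_GR_line_le {𝔸 : Visc4 (Fin 3)} {K₀ : ℝ} (hK₀ : 0 ≤ K₀)
    (hK : ∀ k p q : Fin 3 → ℝ, ∑ i, p i * k i = 0 → ∑ i, q i * k i = 0 →
      |bsymb 𝔸 k p q| ≤ K₀ * (∑ a, k a ^ 2) * (Real.sqrt (∑ i, p i ^ 2) * Real.sqrt (∑ i, q i ^ 2)))
    (k δ p q : Fin 3 → ℝ) {σ : ℝ} (hσ : |σ| * Real.sqrt (nsqR δ) ≤ Real.sqrt (nsqR k)) :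
    |GR 𝔸 (k + σ • δ) p q| ≤ 64 * K₀ * nsqR k ^ 3 * (Real.sqrt (∑ i, p i ^ 2) * Real.sqrt (∑ i, q i ^ 2)) := by
  have h := abs_GR_le hK₀ hK (k + σ • δ) p q
  have hle : nsqR (k + σ • δ) ≤ 4 * nsqR k := by
    calc nsqR (k + σ • δ) ≤ (Real.sqrt (nsqR k) + |σ| * Real.sqrt (nsqR δ)) ^ 2 := nsqR_add_smul_le k δ σ
      _ ≤ (Real.sqrt (nsqR k) + Real.sqrt (nsqR k)) ^ 2 := by gcongr
      _ = 4 * nsqR k := by rw [← two_mul, mul_pow, Real.sq_sqrt (nsqR_nonneg k)]; norm_num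
  have h3 : nsqR (k + σ • δ) ^ 3 ≤ 64 * nsqR k ^ 3 := by
    calc nsqR (k + σ • δ) ^ 3 ≤ (4 * nsqR k) ^ 3 := by gcongr; exact nsqR_nonneg _
      _ = 64 * nsqR k ^ 3 := by ring
  refine le_trans h ?_
  have hPQ : 0 ≤ Real.sqrt (∑ i, p i ^ 2) * Real.sqrt (∑ i, q i ^ 2) := by positivity
  calc K₀ * nsqR (k + σ • δ) ^ 3 * (Real.sqrt (∑ i, p i ^ 2) * Real.sqrt (∑ i, q i ^ 2))
      ≤ K₀ * (64 * nsqR k ^ 3) * (Real.sqrt (∑ i, p i ^ 2) * Real.sqrt (∑ i, q i ^ 2)) := by gcongr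
    _ = 64 * K₀ * nsqR k ^ 3 * (Real.sqrt (∑ i, p i ^ 2) * Real.sqrt (∑ i, q i ^ 2)) := by ring

/-! ## §4 The Bernstein–Markov bound of the numerator's derivative -/

/-- **Bernstein–Markov bound for the numerator**: `|N'(0)|·|k| ≤ 352·K₀·|k|⁶·|δ|·|p||q|` (exact seven-point stencil with
step `h = |k|/(3|δ|)` and the node bound). [folklore] -/
theorem abs_derivative_GX_mul_le {𝔸 : Visc4 (Fin 3)} {K₀ : ℝ} (hK₀ : 0 ≤ K₀)
    (hK : ∀ k p q : Fin 3 → ℝ, ∑ i, p i * k i = 0 → ∑ i, q i * k i = 0 →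
      |bsymb 𝔸 k p q| ≤ K₀ * (∑ a, k a ^ 2) * (Real.sqrt (∑ i, p i ^ 2) * Real.sqrt (∑ i, q i ^ 2)))
    (k δ p q : Fin 3 → ℝ) (hk : 0 < nsqR k) (hδ : 0 < nsqR δ) :
    |(GX 𝔸 k δ p q).derivative.eval 0| * Real.sqrt (nsqR k)
      ≤ 352 * K₀ * nsqR k ^ 3 * Real.sqrt (nsqR δ) * (Real.sqrt (∑ i, p i ^ 2) * Real.sqrt (∑ i, q i ^ 2)) := by
  set a := Real.sqrt (nsqR k) with ha
  set b := Real.sqrt (nsqR δ) with hb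
  have ha0 : 0 < a := Real.sqrt_pos.2 hk
  have hb0 : 0 < b := Real.sqrt_pos.2 hδ
  set h := a / (3 * b) with hh
  have hh0 : 0 < h := by positivity
  set B := 64 * K₀ * nsqR k ^ 3 * (Real.sqrt (∑ i, p i ^ 2) * Real.sqrt (∑ i, q i ^ 2)) with hB
  -- the nodes `σ = j h`, `|j| ≤ 3`, satisfy `|σ|·|δ| ≤ |k|`
  have hnode : ∀ σ : ℝ, |σ| ≤ 3 * h → |GR 𝔸 (k + σ • δ) p q| ≤ B := by
    intro σ hσ
    refine abs_GR_line_le hK₀ hK k δ p q ?_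
    calc |σ| * Real.sqrt (nsqR δ) ≤ (3 * h) * b := by rw [← hb]; gcongr
      _ = a := by rw [hh]; field_simp
  have e := stencil7 (GX 𝔸 k δ p q) (natDegree_GX_le 𝔸 k δ p q) h
  simp only [eval_GX] at e
  have n1 := hnode (-(3 * h)) (by rw [abs_neg, abs_of_pos (by positivity)])
  have n2 := hnode (-(2 * h)) (by rw [abs_neg, abs_of_pos (by positivity)]; linarith)
  have n3 := hnode (-h) (by rw [abs_neg, abs_of_pos hh0]; linarith)
  have n4 := hnode h (by rw [abs_of_pos hh0]; linarith)
  have n5 := hnode (2 * h) (by rw [abs_of_pos (by positivity)]; linarith)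
  have n6 := hnode (3 * h) (by rw [abs_of_pos (by positivity)])
  rw [abs_le] at n1 n2 n3 n4 n5 n6
  have e60 : |60 * h * (GX 𝔸 k δ p q).derivative.eval 0| ≤ 110 * B := by
    rw [e, abs_le]; constructor <;> linarith [n1.1, n1.2, n2.1, n2.2, n3.1, n3.2, n4.1, n4.2, n5.1, n5.2, n6.1, n6.2]
  -- `60 h · b = 20 a`
  have e20 : |(GX 𝔸 k δ p q).derivative.eval 0| * a * 20 = |60 * h * (GX 𝔸 k δ p q).derivative.eval 0| * b := by
    rw [abs_mul, abs_of_pos (by positivity : (0:ℝ) < 60 * h), hh]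
    field_simp
    ring
  have : |(GX 𝔸 k δ p q).derivative.eval 0| * a * 20 ≤ 110 * B * b := by
    rw [e20]; exact mul_le_mul_of_nonneg_right e60 hb0.le
  rw [hB] at this
  nlinarith [this]

end Summit.AnomalousDissipation.AnomalousDissipation.Theorems.SolenoidalFractalHomogenisation.LagrangianStep.SymbolLipschitz

end
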